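import Summits.HodgeConjecture.CorCM.MultiFieldWeilHodge
import Summits.HodgeConjecture.CorCM.SexticOcticDecicWeilRealised
import Summits.HodgeConjecture.CorCM.SexticDecicWeilHodgeOfMarkman
import HarnessLib

/-!
# COR-CM — THREE FIELDS `6 + 8 + 10`: the Hodge conjecture for every product of copies of `E`, `T`, `B₄`, `B₅` — a `(1,2)`-threefold over a
# SEXTIC, a `(1,3)`-fourfold over an OCTIC and a `(2,3)`-fivefold over a DECIC CM field sharing `k` — modulo Markman's fourfold and
# hyperbolic-sixfold theorems, with NO hypothesis on the fields (first consumer of the multi-field Weil engine)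

Cell `pub-hodgecm2` (COR-CM), seat b30 gen 28 (2026-08-23); count-neutral own lane.  Theorems only; no definition, no named fact, no `sorry`.
HONEST FRAMING: `HC_CM` is NOT proved and not asserted.  The only deep inputs are the two displayed Markman facts
`Markman2025_weilClasses_algebraic_abelianFourfold` and `Markman2025_weilClasses_algebraic_hyperbolicSixfold`.

THE RESULT (`hodgeConjectureFor_biproduct_comp_vec_of_markman`).  `k` ANY imaginary quadratic field, `K₁ ⊇ i₁(k)` ANY sextic, `K₂ ⊇ i₂(k)` ANY
octic, `K₃ ⊇ i₃(k)` ANY decic CM field; `E ⊨ (k; Ψ)` the CM curve (`τ ∈ Ψ`), `T ⊨ (K₁; Φ₁)` a CM threefold of `k`-signature `(1,2)`, `B₄ ⊨ (K₂; Φ₂)`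
a CM fourfold of `k`-signature `(1,3)`, `B₅ ⊨ (K₃; Φ₃)` a CM fivefold of `k`-signature `(2,3)`: the Hodge conjecture holds for EVERY product of
copies `E^a × T^n × B₄^m × B₅^l` (any order: `⨁_j ![E, T, B₄, B₅] (κ j)`, `κ : Fin N → Fin 4`) and for everything dominated by one — NO
hypothesis relating the three fields, NO Galois hypothesis.
THE PROOF = the generic headline `MultiFieldWeil.hodgeConjectureFor_biproduct_comp_of_defectLawG` with (i) the defect law of the realised
tuples (`SexticOcticDecicWeil.exists_hasDefectsG_realisedTuples3`: a realised rotation of the five decic pairs + joint transitivity on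
`Fib₁ × Fib₂`) and (ii) the three single-slot Weil spaces: `T ⊞ E` (b24ʼs `WeilFourfold.…cmThreefold_biprod_cmCurve`, Markman 4),
`B₄ × E × E` (gen 18ʼs `OcticCurveFourfold.…_of_markmanSixfold`, Markman 6), `B₅ × E` (b09ʼs `DecicCurveFivefold.…_of_markmanSixfold`,
Markman 6) — fed with the type counts of the three readings (gens 25–27 BY NAME).  In particular the Hodge rings contain, besides the Weil
classes of the two-field chains (`(6,8)`, `(6,10)`, `(8,10)`: fourfold, sixfolds, eightfolds, tenfolds, fourteenfold), the NEW twelvefold Weil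
class of `T × B̄₄ × B₅` — all algebraic modulo the two facts, with no separate treatment (the engine).
[cite: Markman2025SurveySecant, Thm. 1.2] [cite: Markman2025SecantWeil, Thm 1.5.1] [cite: Pohlmann1968, Thm 1]
[cite: Milne2020HodgeClassesAV, 1.2 (a) and Thm. 1] [cite: MumfordAV1970, §19]

## References
* [Markman2025SurveySecant] E. Markman, survey, Thm. 1.2.  [Markman2025SecantWeil] E. Markman, Thm 1.5.1.  [Pohlmann1968] H. Pohlmann,
  Ann. of Math. 88 (1968), Thm 1.  [Milne2020HodgeClassesAV] J. S. Milne, arXiv:2010.08857, 1.2 (a), Thm. 1.  [MumfordAV1970] D. Mumford,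
  *Abelian Varieties*, §19.
-/

noncomputable section

open CategoryTheory CategoryTheory.Limits NumberField

namespace Summit.HodgeConjecture.CorCM.SexticOcticDecicWeil

open Literature.AlgebraicGeometry Literature.AlgebraicGeometry.Motives Literature.AlgebraicGeometry.HodgeTheory
open Literature.AlgebraicGeometry.ComplexMultiplication (IsCMTypeRealisation)
open Literature.AlgebraicGeometry.Pohlmann1968
open Literature.AlgebraicTopology.SingularHomology
open Literature.NumberTheory.ComplexMultiplication
open Summit.HodgeConjecture.CorCM.Census.MultiFieldWeil
open Summit.HodgeConjecture.CorCM.Census.SexticOcticDecicWeil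
open Summit.HodgeConjecture.CorCM.MultiFieldWeil
open Summit.HodgeConjecture.CorCM.SexticOcticWeil (typeCount_fourfold_of_frameS exists_frame_fin card_filter_comp_eq_of_finrank
  card_filter_cmTypeMap_complexConj)
open Summit.HodgeConjecture.CorCM.SexticDecicWeil (typeCount_sixfold_of_frameSD exists_frame_fin₂)
open Summit.HodgeConjecture.CorCM.OcticWeilMulti (typeCount_sixfold_of_frameO)
open Summit.HodgeConjecture.CorCM.DihedralSexticPairCurve (weilClassesOf_biproduct_le_algebraicClasses_of_biprod)
open Summit.HodgeConjecture.CorCM.PairWeights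
open Summit.HodgeConjecture.CorCM.DecicWeil23Pair (avDominatedBy_of_cmType_eq)
open Summit.HodgeConjecture.CorCM.Domination (AVDominatedBy)
open Summit.HodgeConjecture.CorCM.AndreRiemann (sumFam avDominatedBy_prod_of_biproduct avDominatedBy_biproduct_reindex)

open scoped Classical

/-! ## §1 The frame form -/

section Frames

variable {I : Type} {Kf : I → Type} [∀ i, Field (Kf i)] [∀ i, NumberField (Kf i)] [∀ i, IsCMField (Kf i)]
  {i₀ : I} {is : Fin 3 → I} {τ : Kf i₀ →+* ℂ}
  {A : Fin (3 + 1) → AbelianVariety ℂ} {Φ : ∀ j : Fin (3 + 1), CMType (Kf (mfSlots i₀ is j))}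
  {ι : ∀ j, 𝓞 (Kf (mfSlots i₀ is j)) →+* End (A j)}
  {θ : ∀ j, Kf (mfSlots i₀ is j) →+* Module.End ℂ (complexBetti (A j).X 1)}

/-- **MAIN THEOREM (frame form).  The Hodge conjecture for every product of copies `⨁_j A(κ j)` of `E, T, B₄, B₅` — GIVEN ONLY Markman's fourfold
theorem (the Weil classes of `T × E`) and hyperbolic-sixfold theorem (the Weil classes of `B₄ × E × E` and of `B₅ × E`)**, for `E = A 0 ⊨ (k; {τ})`,
`T = A 1 ⊨ (K₁; Φ 1)` over a SEXTIC `K₁ ⊇ i₁(k)` (one member over `τ`, position `0` of `e₁`), `B₄ = A 2 ⊨ (K₂; Φ 2)` over an OCTIC `K₂ ⊇ i₂(k)`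
(one member over `τ`, position `0` of `e₂`), `B₅ = A 3 ⊨ (K₃; Φ 3)` over a DECIC `K₃ ⊇ i₃(k)` (two members over `τ`, positions `0, 1` of `e₃`); NO
hypothesis relating the fields.  `HC_CM` is NOT asserted. [cite: Markman2025SurveySecant, Thm. 1.2] [cite: Markman2025SecantWeil, Thm 1.5.1]
[cite: Pohlmann1968, Thm 1] [cite: Milne2020HodgeClassesAV, 1.2 (a) and Thm. 1] -/
theorem hodgeConjectureFor_biproduct_comp_of_frames_of_markman
    (hW4 : Markman2025_weilClasses_algebraic_abelianFourfold) (hM6 : Markman2025_weilClasses_algebraic_hyperbolicSixfold)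
    {N : ℕ} (κ : Fin N → Fin (3 + 1)) (h6 : Module.finrank ℚ (Kf (is 0)) = 6) (h8 : Module.finrank ℚ (Kf (is 1)) = 8)
    (h10 : Module.finrank ℚ (Kf (is 2)) = 10) (h2 : Module.finrank ℚ (Kf i₀) = 2)
    (i₁ : Kf i₀ →+* Kf (is 0)) (i₂ : Kf i₀ →+* Kf (is 1)) (i₃ : Kf i₀ →+* Kf (is 2))
    {δ : 𝓞 (Kf i₀)} {d : ℕ} (hd : 0 < d) (hδ : ((δ : Kf i₀)) ^ 2 = -(d : Kf i₀)) (hτ : τ (δ : Kf i₀) = Complex.I * (Real.sqrt d : ℂ))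
    (hA : ∀ j, IsCMTypeRealisation (Φ j) (A j) (ι j) (θ j))
    (e₁ : (Kf (is 0) →+* ℂ) ≃ Fin 3 × Bool) (e₂ : (Kf (is 1) →+* ℂ) ≃ Fin 4 × Bool) (e₃ : (Kf (is 2) →+* ℂ) ≃ Fin 5 × Bool)
    (he₁_sign : ∀ s, (e₁ s).2 = true ↔ s.comp i₁ = τ) (he₂_sign : ∀ s, (e₂ s).2 = true ↔ s.comp i₂ = τ)
    (he₃_sign : ∀ s, (e₃ s).2 = true ↔ s.comp i₃ = τ)
    (he₁_conj : ∀ s, e₁ (ComplexEmbedding.conjugate s) = ((e₁ s).1, !(e₁ s).2))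
    (he₂_conj : ∀ s, e₂ (ComplexEmbedding.conjugate s) = ((e₂ s).1, !(e₂ s).2))
    (he₃_conj : ∀ s, e₃ (ComplexEmbedding.conjugate s) = ((e₃ s).1, !(e₃ s).2))
    (hΨ : ∀ σ : Kf i₀ →+* ℂ, σ ∈ (Φ 0).1 ↔ σ = τ)
    (hΦ₁ : ∀ s : Kf (is 0) →+* ℂ, s ∈ (Φ 1).1 ↔ (e₁ s).2 = decide ((e₁ s).1 = 0))
    (hΦ₂ : ∀ s : Kf (is 1) →+* ℂ, s ∈ (Φ 2).1 ↔ (e₂ s).2 = decide ((e₂ s).1 = 0))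
    (hΦ₃ : ∀ s : Kf (is 2) →+* ℂ, s ∈ (Φ 3).1 ↔ (e₃ s).2 = decide ((e₃ s).1 = 0 ∨ (e₃ s).1 = 1)) :
    HodgeConjectureFor (⨁ fun j => A (κ j)).dim (⨁ fun j => A (κ j)).X := by
  -- the three Weil spaces, algebraic by Markman's theorems
  have hW0 : weilClassesOf (A 1 ⊞ A 0) (biprod.map (ι 1 (RingOfIntegers.mapRingHom i₁ δ)) (ι 0 δ)) 2 d ≤ algebraicClasses (A 1 ⊞ A 0).X 2 :=
    WeilFourfold.weilClassesOf_le_algebraicClasses_cmThreefold_biprod_cmCurve hW4 h6 h2 i₁ (hA 1) (hA 0) hd hδ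
      fun τ' => typeCount_fourfold_of_frameS h2 he₁_sign hΦ₁ hΨ τ'
  have hP : ((Finset.univ : Finset (Fin 4)).filter fun a => (fun (_ : Fin 1) (a : Fin 4) => decide (a = 0)) 0 a = true).card = 1 := by
    decide
  have hW1 : weilClassesOf (((A 2).prod (A 0)).prod (A 0))
      (AbelianVariety.prodLift
        (AbelianVariety.fst ((A 2).prod (A 0)) (A 0) ≫
          AbelianVariety.prodLift (AbelianVariety.fst (A 2) (A 0) ≫ ι 2 (RingOfIntegers.mapRingHom i₂ δ))
            (AbelianVariety.snd (A 2) (A 0) ≫ ι 0 δ))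
        (AbelianVariety.snd ((A 2).prod (A 0)) (A 0) ≫ ι 0 δ)) 3 d ≤ algebraicClasses (((A 2).prod (A 0)).prod (A 0)).X 3 :=
    OcticCurveFourfold.weilClassesOf_le_algebraicClasses_cmFourfold_prod_cmCurve_prod_cmCurve_of_markmanSixfold hM6 h8 h2 i₂ (hA 2) (hA 0) hd hδ
      fun τ' => typeCount_sixfold_of_frameO (P := fun (_ : Fin 1) (a : Fin 4) => decide (a = 0)) (m := 0) h2 he₂_sign hP hΦ₂ hΨ τ'
  have hW2 : weilClassesOf ((A 3).prod (A 0))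
      (AbelianVariety.prodLift (AbelianVariety.fst (A 3) (A 0) ≫ ι 3 (RingOfIntegers.mapRingHom i₃ δ))
        (AbelianVariety.snd (A 3) (A 0) ≫ ι 0 δ)) 3 d ≤ algebraicClasses ((A 3).prod (A 0)).X 3 :=
    DecicCurveFivefold.weilClassesOf_le_algebraicClasses_cmFivefold_prod_cmCurve_of_markmanSixfold hM6 h10 h2 i₃ (hA 3) (hA 0) hd hδ
      fun τ' => typeCount_sixfold_of_frameSD h2 he₃_sign hΦ₃ hΨ τ'
  -- … read on the sub-products `⨁_i A(partSlots (c3 m) m i)`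
  have hW : ∀ m : Fin 3, weilClassesOf (⨁ fun i => A (partSlots (c3 m) m i))
      (biproduct.map fun i => ι (partSlots (c3 m) m i) (δfam (im3 is i₁ i₂ i₃) δ (partSlots (c3 m) m i))) (w3 m) d ≤
      algebraicClasses (⨁ fun i => A (partSlots (c3 m) m i)).X (w3 m) := by
    intro m
    refine Fin.cases ?_ (fun m => Fin.cases ?_ (fun m => Fin.cases ?_ (fun m => m.elim0) m) m) m
    · exact weilClassesOf_biproduct_le_algebraicClasses_of_biprod (A := fun i => A (partSlots 1 0 i))
        (fun i => ι (partSlots 1 0 i) (δfam (im3 is i₁ i₂ i₃) δ (partSlots 1 0 i))) hW0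
    · exact OcticCurveFourfold.weilClassesOf_biproduct₃_le_algebraicClasses_of_prod (A := fun i => A (partSlots 2 1 i))
        (fun i => ι (partSlots 2 1 i) (δfam (im3 is i₁ i₂ i₃) δ (partSlots 2 1 i))) hW1
    · exact weilClassesOf_biproduct_le_algebraicClasses_of_prod (A := fun i => A (partSlots 1 2 i))
        (fun i => ι (partSlots 1 2 i) (δfam (im3 is i₁ i₂ i₃) δ (partSlots 1 2 i))) hW2
  -- the generic headline, with the defect law of the realised tuples
  exact hodgeConjectureFor_biproduct_comp_of_defectLawG (is := is) P3 c3 w3 n3_add_c3 c3_lt_n3 κ h2 (im3 is i₁ i₂ i₃) hτ hA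
    (e3 is e₁ e₂ e₃) (he3_sign (is := is) he₁_sign he₂_sign he₃_sign) (he3_conj (is := is) he₁_conj he₂_conj he₃_conj) hΨ
    (hΦ3 (is := is) hΦ₁ hΦ₂ hΦ₃)
    (fun v T hT => exists_hasDefectsG_realisedTuples3 he₁_sign he₂_sign he₃_sign h2 h6 h8 v T hT) hW

/-- **The Hodge conjecture for every abelian variety dominated by a product of copies `⨁_j A(κ j)` of `E, T, B₄, B₅`** (frame form): abelian
subvarieties, quotients and isogeny images. [cite: Markman2025SurveySecant, Thm. 1.2] [cite: Markman2025SecantWeil, Thm 1.5.1] [cite: MumfordAV1970, §19] -/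
theorem hodgeConjectureFor_of_avDominatedBy_comp_of_frames_of_markman
    (hW4 : Markman2025_weilClasses_algebraic_abelianFourfold) (hM6 : Markman2025_weilClasses_algebraic_hyperbolicSixfold)
    {N : ℕ} (κ : Fin N → Fin (3 + 1)) (h6 : Module.finrank ℚ (Kf (is 0)) = 6) (h8 : Module.finrank ℚ (Kf (is 1)) = 8)
    (h10 : Module.finrank ℚ (Kf (is 2)) = 10) (h2 : Module.finrank ℚ (Kf i₀) = 2)
    (i₁ : Kf i₀ →+* Kf (is 0)) (i₂ : Kf i₀ →+* Kf (is 1)) (i₃ : Kf i₀ →+* Kf (is 2))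
    {δ : 𝓞 (Kf i₀)} {d : ℕ} (hd : 0 < d) (hδ : ((δ : Kf i₀)) ^ 2 = -(d : Kf i₀)) (hτ : τ (δ : Kf i₀) = Complex.I * (Real.sqrt d : ℂ))
    (hA : ∀ j, IsCMTypeRealisation (Φ j) (A j) (ι j) (θ j))
    (e₁ : (Kf (is 0) →+* ℂ) ≃ Fin 3 × Bool) (e₂ : (Kf (is 1) →+* ℂ) ≃ Fin 4 × Bool) (e₃ : (Kf (is 2) →+* ℂ) ≃ Fin 5 × Bool)
    (he₁_sign : ∀ s, (e₁ s).2 = true ↔ s.comp i₁ = τ) (he₂_sign : ∀ s, (e₂ s).2 = true ↔ s.comp i₂ = τ)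
    (he₃_sign : ∀ s, (e₃ s).2 = true ↔ s.comp i₃ = τ)
    (he₁_conj : ∀ s, e₁ (ComplexEmbedding.conjugate s) = ((e₁ s).1, !(e₁ s).2))
    (he₂_conj : ∀ s, e₂ (ComplexEmbedding.conjugate s) = ((e₂ s).1, !(e₂ s).2))
    (he₃_conj : ∀ s, e₃ (ComplexEmbedding.conjugate s) = ((e₃ s).1, !(e₃ s).2))
    (hΨ : ∀ σ : Kf i₀ →+* ℂ, σ ∈ (Φ 0).1 ↔ σ = τ)
    (hΦ₁ : ∀ s : Kf (is 0) →+* ℂ, s ∈ (Φ 1).1 ↔ (e₁ s).2 = decide ((e₁ s).1 = 0))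
    (hΦ₂ : ∀ s : Kf (is 1) →+* ℂ, s ∈ (Φ 2).1 ↔ (e₂ s).2 = decide ((e₂ s).1 = 0))
    (hΦ₃ : ∀ s : Kf (is 2) →+* ℂ, s ∈ (Φ 3).1 ↔ (e₃ s).2 = decide ((e₃ s).1 = 0 ∨ (e₃ s).1 = 1))
    {X : AbelianVariety ℂ} (hX : Domination.AVDominatedBy X (⨁ fun j => A (κ j))) :
    HodgeConjectureFor X.dim X.X :=
  Domination.hodgeConjectureFor_of_avDominatedBy
    (hodgeConjectureFor_biproduct_comp_of_frames_of_markman hW4 hM6 κ h6 h8 h10 h2 i₁ i₂ i₃ hd hδ hτ hA e₁ e₂ e₃ he₁_sign he₂_sign he₃_sign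
      he₁_conj he₂_conj he₃_conj hΨ hΦ₁ hΦ₂ hΦ₃) hX

end Frames

/-! ## §2 The intrinsic theorem for `⨁_j ![E, T, B₄, B₅] (κ j)` -/

section Vec

variable {k K₁ K₂ K₃ : Type} [Field k] [NumberField k] [IsCMField k] [Field K₁] [NumberField K₁] [IsCMField K₁]
  [Field K₂] [NumberField K₂] [IsCMField K₂] [Field K₃] [NumberField K₃] [IsCMField K₃] {N : ℕ}
  {E T B₄ B₅ : AbelianVariety ℂ} {Ψ : CMType k} {Φ₁ : CMType K₁} {Φ₂ : CMType K₂} {Φ₃ : CMType K₃}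
  {ιE : 𝓞 k →+* End E} {θE : k →+* Module.End ℂ (complexBetti E.X 1)}
  {ιT : 𝓞 K₁ →+* End T} {θT : K₁ →+* Module.End ℂ (complexBetti T.X 1)}
  {ιB₄ : 𝓞 K₂ →+* End B₄} {θB₄ : K₂ →+* Module.End ℂ (complexBetti B₄.X 1)}
  {ιB₅ : 𝓞 K₃ →+* End B₅} {θB₅ : K₃ →+* Module.End ℂ (complexBetti B₅.X 1)}

/-- **MAIN THEOREM (intrinsic form).  The Hodge conjecture for every product of copies of `E`, `T`, `B₄`, `B₅` — `E^a × T^n × B₄^m × B₅^l`, all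
exponents, any order (`⨁_j ![E, T, B₄, B₅] (κ j)`, `κ : Fin N → Fin 4`) — GIVEN ONLY Markman's fourfold and hyperbolic-sixfold theorems**, where
`k` is an imaginary quadratic field, `K₁ ⊇ i₁(k)` ANY sextic, `K₂ ⊇ i₂(k)` ANY octic, `K₃ ⊇ i₃(k)` ANY decic CM field, `E ⊨ (k; Ψ)` a CM elliptic
curve (`τ ∈ Ψ`), `T ⊨ (K₁; Φ₁)` a CM threefold whose type has exactly ONE member over `τ` (`k`-signature `(1,2)`), `B₄ ⊨ (K₂; Φ₂)` a CM fourfold with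
exactly ONE member over `τ` (`(1,3)`), `B₅ ⊨ (K₃; Φ₃)` a CM fivefold with exactly TWO members over `τ` (`(2,3)`).  NO hypothesis relating the
three fields, NO Galois hypothesis.  `HC_CM` is NOT asserted. [cite: Markman2025SurveySecant, Thm. 1.2] [cite: Markman2025SecantWeil, Thm 1.5.1]
[cite: Pohlmann1968, Thm 1] -/
theorem hodgeConjectureFor_biproduct_comp_vec_of_markman
    (hW4 : Markman2025_weilClasses_algebraic_abelianFourfold) (hM6 : Markman2025_weilClasses_algebraic_hyperbolicSixfold)
    (h2 : Module.finrank ℚ k = 2) (h6 : Module.finrank ℚ K₁ = 6) (h8 : Module.finrank ℚ K₂ = 8) (h10 : Module.finrank ℚ K₃ = 10)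
    (i₁ : k →+* K₁) (i₂ : k →+* K₂) (i₃ : k →+* K₃)
    (hE : IsCMTypeRealisation Ψ E ιE θE) (hT : IsCMTypeRealisation Φ₁ T ιT θT) (hB₄ : IsCMTypeRealisation Φ₂ B₄ ιB₄ θB₄)
    (hB₅ : IsCMTypeRealisation Φ₃ B₅ ιB₅ θB₅) {τ : k →+* ℂ} (hτΨ : τ ∈ Ψ.1)
    (h12 : (Finset.univ.filter fun s : K₁ →+* ℂ => s.comp i₁ = τ ∧ s ∈ Φ₁.1).card = 1)
    (h13 : (Finset.univ.filter fun t : K₂ →+* ℂ => t.comp i₂ = τ ∧ t ∈ Φ₂.1).card = 1)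
    (h23 : (Finset.univ.filter fun u : K₃ →+* ℂ => u.comp i₃ = τ ∧ u ∈ Φ₃.1).card = 2)
    (κ : Fin N → Fin 4) :
    HodgeConjectureFor (⨁ fun j => (![E, T, B₄, B₅] : Fin 4 → AbelianVariety ℂ) (κ j)).dim
      (⨁ fun j => (![E, T, B₄, B₅] : Fin 4 → AbelianVariety ℂ) (κ j)).X := by
  have hττ : ComplexEmbedding.conjugate τ ≠ τ := QuarticCM.conjugate_ne τ
  have hk : ∀ σ : k →+* ℂ, σ = τ ∨ σ = ComplexEmbedding.conjugate τ := fun σ => QuarticCM.eq_or_eq_conjugate_of_quadratic h2 τ σ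
  have hΨ : ∀ σ : k →+* ℂ, σ ∈ Ψ.1 ↔ σ = τ := by
    intro σ
    rcases hk σ with rfl | rfl
    · exact ⟨fun _ => rfl, fun _ => hτΨ⟩
    · exact ⟨fun h => absurd h ((Ψ.2 τ).1 hτΨ), fun h => absurd h hττ⟩
  obtain ⟨δ₀, d, hd, hδ₀⟩ := CyclicSextic.exists_sq_eq_neg_nat_of_isTotallyComplex k h2
  obtain ⟨δ, hδ, hτ⟩ := OcticCurveFourfold.exists_delta_of_mem h2 hd hδ₀ τ
  -- the three frames
  obtain ⟨e₁, he₁_sign, he₁_conj, hΦ₁⟩ := exists_frame_fin (n := 2) i₁ hττ hk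
    (card_filter_comp_eq_of_finrank (n := 3) i₁ h6 h2 τ) Φ₁ h12
  obtain ⟨e₂, he₂_sign, he₂_conj, hΦ₂⟩ := exists_frame_fin (n := 3) i₂ hττ hk
    (card_filter_comp_eq_of_finrank (n := 4) i₂ h8 h2 τ) Φ₂ h13
  obtain ⟨e₃, he₃_sign, he₃_conj, hΦ₃⟩ := exists_frame_fin₂ h10 h2 i₃ hττ hk Φ₃ h23
  -- the family of fields `(k, K₁, K₂, K₃)` with its instances (all identifications below are definitional)
  let Kf : Fin 4 → Type := Fin.cons k (Fin.cons K₁ (Fin.cons K₂ (Fin.cons K₃ finZeroElim)))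
  letI instF : ∀ j, Field (Kf j) := Fin.cons ‹Field k› (Fin.cons ‹Field K₁› (Fin.cons ‹Field K₂› (Fin.cons ‹Field K₃› finZeroElim)))
  letI instN : ∀ j, NumberField (Kf j) :=
    Fin.cons ‹NumberField k› (Fin.cons ‹NumberField K₁› (Fin.cons ‹NumberField K₂› (Fin.cons ‹NumberField K₃› finZeroElim)))
  haveI instC : ∀ j, IsCMField (Kf j) :=
    Fin.cons ‹IsCMField k› (Fin.cons ‹IsCMField K₁› (Fin.cons ‹IsCMField K₂› (Fin.cons ‹IsCMField K₃› finZeroElim)))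
  -- the data over the four slots `mfSlots 0 Fin.succ = (0, 1, 2, 3)`
  let Φ₄ : ∀ j : Fin 4, CMType (Kf (mfSlots (0 : Fin 4) Fin.succ j)) := Fin.cons Ψ (Fin.cons Φ₁ (Fin.cons Φ₂ (Fin.cons Φ₃ finZeroElim)))
  let ι₄ : ∀ j : Fin 4, 𝓞 (Kf (mfSlots (0 : Fin 4) Fin.succ j)) →+* End ((![E, T, B₄, B₅] : Fin 4 → AbelianVariety ℂ) j) :=
    Fin.cons ιE (Fin.cons ιT (Fin.cons ιB₄ (Fin.cons ιB₅ finZeroElim)))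
  let θ₄ : ∀ j : Fin 4, Kf (mfSlots (0 : Fin 4) Fin.succ j) →+*
      Module.End ℂ (complexBetti ((![E, T, B₄, B₅] : Fin 4 → AbelianVariety ℂ) j).X 1) :=
    Fin.cons θE (Fin.cons θT (Fin.cons θB₄ (Fin.cons θB₅ finZeroElim)))
  have hA : ∀ j, IsCMTypeRealisation (Φ₄ j) ((![E, T, B₄, B₅] : Fin 4 → AbelianVariety ℂ) j) (ι₄ j) (θ₄ j) :=
    Fin.cons hE (Fin.cons hT (Fin.cons hB₄ (Fin.cons hB₅ finZeroElim)))
  exact hodgeConjectureFor_biproduct_comp_of_frames_of_markman (Kf := Kf) (i₀ := (0 : Fin 4)) (is := Fin.succ)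
    (A := (![E, T, B₄, B₅] : Fin 4 → AbelianVariety ℂ)) (Φ := Φ₄) (ι := ι₄) (θ := θ₄)
    hW4 hM6 κ h6 h8 h10 h2 i₁ i₂ i₃ hd hδ hτ hA e₁ e₂ e₃ he₁_sign he₂_sign he₃_sign he₁_conj he₂_conj he₃_conj hΨ hΦ₁ hΦ₂ hΦ₃

/-- **The Hodge conjecture for every abelian variety dominated by a product of copies of `E`, `T`, `B₄`, `B₅`** (intrinsic form): abelian
subvarieties, quotients and isogeny images of the `E^a × T^n × B₄^m × B₅^l`, modulo Markman's two theorems.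
[cite: Markman2025SurveySecant, Thm. 1.2] [cite: Markman2025SecantWeil, Thm 1.5.1] [cite: MumfordAV1970, §19] -/
theorem hodgeConjectureFor_of_avDominatedBy_comp_vec_of_markman
    (hW4 : Markman2025_weilClasses_algebraic_abelianFourfold) (hM6 : Markman2025_weilClasses_algebraic_hyperbolicSixfold)
    (h2 : Module.finrank ℚ k = 2) (h6 : Module.finrank ℚ K₁ = 6) (h8 : Module.finrank ℚ K₂ = 8) (h10 : Module.finrank ℚ K₃ = 10)
    (i₁ : k →+* K₁) (i₂ : k →+* K₂) (i₃ : k →+* K₃)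
    (hE : IsCMTypeRealisation Ψ E ιE θE) (hT : IsCMTypeRealisation Φ₁ T ιT θT) (hB₄ : IsCMTypeRealisation Φ₂ B₄ ιB₄ θB₄)
    (hB₅ : IsCMTypeRealisation Φ₃ B₅ ιB₅ θB₅) {τ : k →+* ℂ} (hτΨ : τ ∈ Ψ.1)
    (h12 : (Finset.univ.filter fun s : K₁ →+* ℂ => s.comp i₁ = τ ∧ s ∈ Φ₁.1).card = 1)
    (h13 : (Finset.univ.filter fun t : K₂ →+* ℂ => t.comp i₂ = τ ∧ t ∈ Φ₂.1).card = 1)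
    (h23 : (Finset.univ.filter fun u : K₃ →+* ℂ => u.comp i₃ = τ ∧ u ∈ Φ₃.1).card = 2)
    (κ : Fin N → Fin 4) {X : AbelianVariety ℂ}
    (hX : Domination.AVDominatedBy X (⨁ fun j => (![E, T, B₄, B₅] : Fin 4 → AbelianVariety ℂ) (κ j))) :
    HodgeConjectureFor X.dim X.X :=
  Domination.hodgeConjectureFor_of_avDominatedBy
    (hodgeConjectureFor_biproduct_comp_vec_of_markman hW4 hM6 h2 h6 h8 h10 i₁ i₂ i₃ hE hT hB₄ hB₅ hτΨ h12 h13 h23 κ) hX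

/-- **All `k`-signatures `(1,2)/(2,1) × (1,3)/(3,1) × (2,3)/(3,2)`**: a type with the complementary count over `τ` is the conjugate type, realised
by the conjugate structure (`IsCMTypeRealisation.transport` along complex conjugation of the CM field), so the headline applies.
[cite: Markman2025SurveySecant, Thm. 1.2] [cite: Markman2025SecantWeil, Thm 1.5.1] [cite: Pohlmann1968, Thm 1] -/
theorem hodgeConjectureFor_biproduct_comp_vec_of_markman_of_signs
    (hW4 : Markman2025_weilClasses_algebraic_abelianFourfold) (hM6 : Markman2025_weilClasses_algebraic_hyperbolicSixfold)
    (h2 : Module.finrank ℚ k = 2) (h6 : Module.finrank ℚ K₁ = 6) (h8 : Module.finrank ℚ K₂ = 8) (h10 : Module.finrank ℚ K₃ = 10)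
    (i₁ : k →+* K₁) (i₂ : k →+* K₂) (i₃ : k →+* K₃)
    (hE : IsCMTypeRealisation Ψ E ιE θE) (hT : IsCMTypeRealisation Φ₁ T ιT θT) (hB₄ : IsCMTypeRealisation Φ₂ B₄ ιB₄ θB₄)
    (hB₅ : IsCMTypeRealisation Φ₃ B₅ ιB₅ θB₅) {τ : k →+* ℂ} (hτΨ : τ ∈ Ψ.1)
    (h12 : (Finset.univ.filter fun s : K₁ →+* ℂ => s.comp i₁ = τ ∧ s ∈ Φ₁.1).card = 1 ∨
      (Finset.univ.filter fun s : K₁ →+* ℂ => s.comp i₁ = τ ∧ s ∈ Φ₁.1).card = 2)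
    (h13 : (Finset.univ.filter fun t : K₂ →+* ℂ => t.comp i₂ = τ ∧ t ∈ Φ₂.1).card = 1 ∨
      (Finset.univ.filter fun t : K₂ →+* ℂ => t.comp i₂ = τ ∧ t ∈ Φ₂.1).card = 3)
    (h23 : (Finset.univ.filter fun u : K₃ →+* ℂ => u.comp i₃ = τ ∧ u ∈ Φ₃.1).card = 2 ∨
      (Finset.univ.filter fun u : K₃ →+* ℂ => u.comp i₃ = τ ∧ u ∈ Φ₃.1).card = 3)
    (κ : Fin N → Fin 4) :
    HodgeConjectureFor (⨁ fun j => (![E, T, B₄, B₅] : Fin 4 → AbelianVariety ℂ) (κ j)).dim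
      (⨁ fun j => (![E, T, B₄, B₅] : Fin 4 → AbelianVariety ℂ) (κ j)).X := by
  have hn₁ := card_filter_comp_eq_of_finrank (n := 3) i₁ h6 h2 τ
  have hn₂ := card_filter_comp_eq_of_finrank (n := 4) i₂ h8 h2 τ
  have hn₃ := card_filter_comp_eq_of_finrank (n := 5) i₃ h10 h2 τ
  -- normalise `T` to one member over `τ`
  have hT' : ∃ (Φ₁' : CMType K₁) (ιT' : 𝓞 K₁ →+* End T) (θT' : K₁ →+* Module.End ℂ (complexBetti T.X 1)),
      IsCMTypeRealisation Φ₁' T ιT' θT' ∧ (Finset.univ.filter fun s : K₁ →+* ℂ => s.comp i₁ = τ ∧ s ∈ Φ₁'.1).card = 1 := by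
    rcases h12 with h | h
    · exact ⟨Φ₁, ιT, θT, hT, h⟩
    · refine ⟨_, _, _, hT.transport (IsCMField.complexConj K₁).toRingEquiv, ?_⟩
      rw [card_filter_cmTypeMap_complexConj i₁ τ Φ₁, hn₁, h]
  -- normalise `B₄` to one member over `τ`
  have hB₄' : ∃ (Φ₂' : CMType K₂) (ι' : 𝓞 K₂ →+* End B₄) (θ' : K₂ →+* Module.End ℂ (complexBetti B₄.X 1)),
      IsCMTypeRealisation Φ₂' B₄ ι' θ' ∧ (Finset.univ.filter fun t : K₂ →+* ℂ => t.comp i₂ = τ ∧ t ∈ Φ₂'.1).card = 1 := by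
    rcases h13 with h | h
    · exact ⟨Φ₂, ιB₄, θB₄, hB₄, h⟩
    · refine ⟨_, _, _, hB₄.transport (IsCMField.complexConj K₂).toRingEquiv, ?_⟩
      rw [card_filter_cmTypeMap_complexConj i₂ τ Φ₂, hn₂, h]
  -- normalise `B₅` to two members over `τ`
  have hB₅' : ∃ (Φ₃' : CMType K₃) (ι' : 𝓞 K₃ →+* End B₅) (θ' : K₃ →+* Module.End ℂ (complexBetti B₅.X 1)),
      IsCMTypeRealisation Φ₃' B₅ ι' θ' ∧ (Finset.univ.filter fun u : K₃ →+* ℂ => u.comp i₃ = τ ∧ u ∈ Φ₃'.1).card = 2 := by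
    rcases h23 with h | h
    · exact ⟨Φ₃, ιB₅, θB₅, hB₅, h⟩
    · refine ⟨_, _, _, hB₅.transport (IsCMField.complexConj K₃).toRingEquiv, ?_⟩
      rw [card_filter_cmTypeMap_complexConj i₃ τ Φ₃, hn₃, h]
  obtain ⟨Φ₁', ιT', θT', hT'', h12'⟩ := hT'
  obtain ⟨Φ₂', ι₄', θ₄', hB₄'', h13'⟩ := hB₄'
  obtain ⟨Φ₃', ι₅', θ₅', hB₅'', h23'⟩ := hB₅'
  exact hodgeConjectureFor_biproduct_comp_vec_of_markman hW4 hM6 h2 h6 h8 h10 i₁ i₂ i₃ hE hT'' hB₄'' hB₅'' hτΨ h12' h13' h23' κ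

/-- **Everything dominated, all sign combinations.** [cite: Markman2025SurveySecant, Thm. 1.2] [cite: Markman2025SecantWeil, Thm 1.5.1]
[cite: MumfordAV1970, §19] -/
theorem hodgeConjectureFor_of_avDominatedBy_comp_vec_of_markman_of_signs
    (hW4 : Markman2025_weilClasses_algebraic_abelianFourfold) (hM6 : Markman2025_weilClasses_algebraic_hyperbolicSixfold)
    (h2 : Module.finrank ℚ k = 2) (h6 : Module.finrank ℚ K₁ = 6) (h8 : Module.finrank ℚ K₂ = 8) (h10 : Module.finrank ℚ K₃ = 10)
    (i₁ : k →+* K₁) (i₂ : k →+* K₂) (i₃ : k →+* K₃)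
    (hE : IsCMTypeRealisation Ψ E ιE θE) (hT : IsCMTypeRealisation Φ₁ T ιT θT) (hB₄ : IsCMTypeRealisation Φ₂ B₄ ιB₄ θB₄)
    (hB₅ : IsCMTypeRealisation Φ₃ B₅ ιB₅ θB₅) {τ : k →+* ℂ} (hτΨ : τ ∈ Ψ.1)
    (h12 : (Finset.univ.filter fun s : K₁ →+* ℂ => s.comp i₁ = τ ∧ s ∈ Φ₁.1).card = 1 ∨
      (Finset.univ.filter fun s : K₁ →+* ℂ => s.comp i₁ = τ ∧ s ∈ Φ₁.1).card = 2)
    (h13 : (Finset.univ.filter fun t : K₂ →+* ℂ => t.comp i₂ = τ ∧ t ∈ Φ₂.1).card = 1 ∨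
      (Finset.univ.filter fun t : K₂ →+* ℂ => t.comp i₂ = τ ∧ t ∈ Φ₂.1).card = 3)
    (h23 : (Finset.univ.filter fun u : K₃ →+* ℂ => u.comp i₃ = τ ∧ u ∈ Φ₃.1).card = 2 ∨
      (Finset.univ.filter fun u : K₃ →+* ℂ => u.comp i₃ = τ ∧ u ∈ Φ₃.1).card = 3)
    (κ : Fin N → Fin 4) {X : AbelianVariety ℂ}
    (hX : Domination.AVDominatedBy X (⨁ fun j => (![E, T, B₄, B₅] : Fin 4 → AbelianVariety ℂ) (κ j))) :
    HodgeConjectureFor X.dim X.X :=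
  Domination.hodgeConjectureFor_of_avDominatedBy
    (hodgeConjectureFor_biproduct_comp_vec_of_markman_of_signs hW4 hM6 h2 h6 h8 h10 i₁ i₂ i₃ hE hT hB₄ hB₅ hτΨ h12 h13 h23 κ) hX

end Vec

/-! ## §3 Families of realisations of the three types -/

section Family

variable {k K₁ K₂ K₃ : Type} [Field k] [NumberField k] [IsCMField k] [Field K₁] [NumberField K₁] [IsCMField K₁]
  [Field K₂] [NumberField K₂] [IsCMField K₂] [Field K₃] [NumberField K₃] [IsCMField K₃] {N₁ N₂ N₃ : ℕ}
  {E T B₄ B₅ : AbelianVariety ℂ} {Ψ : CMType k} {Φ₁ : CMType K₁} {Φ₂ : CMType K₂} {Φ₃ : CMType K₃}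
  {ιE : 𝓞 k →+* End E} {θE : k →+* Module.End ℂ (complexBetti E.X 1)}
  {ιT : 𝓞 K₁ →+* End T} {θT : K₁ →+* Module.End ℂ (complexBetti T.X 1)}
  {ιB₄ : 𝓞 K₂ →+* End B₄} {θB₄ : K₂ →+* Module.End ℂ (complexBetti B₄.X 1)}
  {ιB₅ : 𝓞 K₃ →+* End B₅} {θB₅ : K₃ →+* Module.End ℂ (complexBetti B₅.X 1)}
  {Tf : Fin N₁ → AbelianVariety ℂ} {ιTf : ∀ j, 𝓞 K₁ →+* End (Tf j)} {θTf : ∀ j, K₁ →+* Module.End ℂ (complexBetti (Tf j).X 1)}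
  {B₄f : Fin N₂ → AbelianVariety ℂ} {ιB₄f : ∀ j, 𝓞 K₂ →+* End (B₄f j)} {θB₄f : ∀ j, K₂ →+* Module.End ℂ (complexBetti (B₄f j).X 1)}
  {B₅f : Fin N₃ → AbelianVariety ℂ} {ιB₅f : ∀ l, 𝓞 K₃ →+* End (B₅f l)} {θB₅f : ∀ l, K₃ →+* Module.End ℂ (complexBetti (B₅f l).X 1)}

/-- **FAMILIES.  The Hodge conjecture for every abelian variety dominated by `E^a × ∏_j T_j × ∏_j B₄,j × ∏_l B₅,l`**, where the `T_j`, `B₄,j`, `B₅,l`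
are ANY realisations of the three types (two realisations of one CM type are isogenous — `DecicWeil23Pair.avDominatedBy_of_cmType_eq` — so the
product is dominated by a product of copies of the anchors), GIVEN ONLY Markman's two theorems; no hypothesis on the fields.
[cite: Markman2025SurveySecant, Thm. 1.2] [cite: Markman2025SecantWeil, Thm 1.5.1] [cite: MumfordAV1970, §19] -/
theorem hodgeConjectureFor_of_avDominatedBy_families_of_markman
    (hW4 : Markman2025_weilClasses_algebraic_abelianFourfold) (hM6 : Markman2025_weilClasses_algebraic_hyperbolicSixfold)
    (h2 : Module.finrank ℚ k = 2) (h6 : Module.finrank ℚ K₁ = 6) (h8 : Module.finrank ℚ K₂ = 8) (h10 : Module.finrank ℚ K₃ = 10)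
    (i₁ : k →+* K₁) (i₂ : k →+* K₂) (i₃ : k →+* K₃)
    (hE : IsCMTypeRealisation Ψ E ιE θE) (hT : IsCMTypeRealisation Φ₁ T ιT θT) (hB₄ : IsCMTypeRealisation Φ₂ B₄ ιB₄ θB₄)
    (hB₅ : IsCMTypeRealisation Φ₃ B₅ ιB₅ θB₅) {τ : k →+* ℂ} (hτΨ : τ ∈ Ψ.1)
    (h12 : (Finset.univ.filter fun s : K₁ →+* ℂ => s.comp i₁ = τ ∧ s ∈ Φ₁.1).card = 1)
    (h13 : (Finset.univ.filter fun t : K₂ →+* ℂ => t.comp i₂ = τ ∧ t ∈ Φ₂.1).card = 1)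
    (h23 : (Finset.univ.filter fun u : K₃ →+* ℂ => u.comp i₃ = τ ∧ u ∈ Φ₃.1).card = 2)
    (hTf : ∀ j, IsCMTypeRealisation Φ₁ (Tf j) (ιTf j) (θTf j)) (hB₄f : ∀ j, IsCMTypeRealisation Φ₂ (B₄f j) (ιB₄f j) (θB₄f j))
    (hB₅f : ∀ l, IsCMTypeRealisation Φ₃ (B₅f l) (ιB₅f l) (θB₅f l)) (a : ℕ)
    {C : AbelianVariety ℂ} (hC : AVDominatedBy C ((⨁ fun _ : Fin a => E).prod ((⨁ Tf).prod ((⨁ B₄f).prod (⨁ B₅f))))) :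
    HodgeConjectureFor C.dim C.X := by
  let Y : Fin 4 → AbelianVariety ℂ := ![E, T, B₄, B₅]
  have h₀ : AVDominatedBy (⨁ fun _ : Fin a => E) (⨁ fun _ : Fin a => Y 0) :=
    AVDominatedBy.biproduct_map fun _ => AVDominatedBy.refl E
  have h₁ : AVDominatedBy (⨁ Tf) (⨁ fun _ : Fin N₁ => Y 1) :=
    AVDominatedBy.biproduct_map fun j => avDominatedBy_of_cmType_eq rfl (hTf j) hT
  have h₂ : AVDominatedBy (⨁ B₄f) (⨁ fun _ : Fin N₂ => Y 2) :=
    AVDominatedBy.biproduct_map fun j => avDominatedBy_of_cmType_eq rfl (hB₄f j) hB₄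
  have h₃ : AVDominatedBy (⨁ B₅f) (⨁ fun _ : Fin N₃ => Y 3) :=
    AVDominatedBy.biproduct_map fun l => avDominatedBy_of_cmType_eq rfl (hB₅f l) hB₅
  have h := avDominatedBy_prod_of_biproduct h₀ (avDominatedBy_prod_of_biproduct h₁ (avDominatedBy_prod_of_biproduct h₂ h₃))
  let κ' : Fin a ⊕ (Fin N₁ ⊕ (Fin N₂ ⊕ Fin N₃)) → Fin 4 :=
    Sum.elim (fun _ => 0) (Sum.elim (fun _ => 1) (Sum.elim (fun _ => 2) fun _ => 3))
  have hfam : sumFam (fun _ : Fin a => Y 0) (sumFam (fun _ : Fin N₁ => Y 1) (sumFam (fun _ : Fin N₂ => Y 2) (fun _ : Fin N₃ => Y 3))) = Y ∘ κ' :=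
    funext fun x => by rcases x with x | x | x | x <;> rfl
  rw [hfam] at h
  let eqv : Fin (a + (N₁ + (N₂ + N₃))) ≃ Fin a ⊕ (Fin N₁ ⊕ (Fin N₂ ⊕ Fin N₃)) :=
    finSumFinEquiv.symm.trans (Equiv.sumCongr (Equiv.refl _)
      (finSumFinEquiv.symm.trans (Equiv.sumCongr (Equiv.refl _) finSumFinEquiv.symm)))
  have hdom := avDominatedBy_biproduct_reindex eqv h
  exact Domination.hodgeConjectureFor_of_avDominatedBy
    (hodgeConjectureFor_biproduct_comp_vec_of_markman hW4 hM6 h2 h6 h8 h10 i₁ i₂ i₃ hE hT hB₄ hB₅ hτΨ h12 h13 h23 (κ' ∘ eqv)) (hC.trans hdom)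

/-- **In particular: the Hodge conjecture for `∏_j T_j × ∏_j B₄,j × ∏_l B₅,l` itself** (any finite families of realisations of the three types).
[cite: Markman2025SurveySecant, Thm. 1.2] [cite: Markman2025SecantWeil, Thm 1.5.1] [cite: MumfordAV1970, §19] -/
theorem hodgeConjectureFor_biproduct_families_of_markman
    (hW4 : Markman2025_weilClasses_algebraic_abelianFourfold) (hM6 : Markman2025_weilClasses_algebraic_hyperbolicSixfold)
    (h2 : Module.finrank ℚ k = 2) (h6 : Module.finrank ℚ K₁ = 6) (h8 : Module.finrank ℚ K₂ = 8) (h10 : Module.finrank ℚ K₃ = 10)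
    (i₁ : k →+* K₁) (i₂ : k →+* K₂) (i₃ : k →+* K₃)
    (hE : IsCMTypeRealisation Ψ E ιE θE) (hT : IsCMTypeRealisation Φ₁ T ιT θT) (hB₄ : IsCMTypeRealisation Φ₂ B₄ ιB₄ θB₄)
    (hB₅ : IsCMTypeRealisation Φ₃ B₅ ιB₅ θB₅) {τ : k →+* ℂ} (hτΨ : τ ∈ Ψ.1)
    (h12 : (Finset.univ.filter fun s : K₁ →+* ℂ => s.comp i₁ = τ ∧ s ∈ Φ₁.1).card = 1)
    (h13 : (Finset.univ.filter fun t : K₂ →+* ℂ => t.comp i₂ = τ ∧ t ∈ Φ₂.1).card = 1)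
    (h23 : (Finset.univ.filter fun u : K₃ →+* ℂ => u.comp i₃ = τ ∧ u ∈ Φ₃.1).card = 2)
    (hTf : ∀ j, IsCMTypeRealisation Φ₁ (Tf j) (ιTf j) (θTf j)) (hB₄f : ∀ j, IsCMTypeRealisation Φ₂ (B₄f j) (ιB₄f j) (θB₄f j))
    (hB₅f : ∀ l, IsCMTypeRealisation Φ₃ (B₅f l) (ιB₅f l) (θB₅f l)) :
    HodgeConjectureFor ((⨁ Tf).prod ((⨁ B₄f).prod (⨁ B₅f))).dim ((⨁ Tf).prod ((⨁ B₄f).prod (⨁ B₅f))).X :=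
  hodgeConjectureFor_of_avDominatedBy_families_of_markman hW4 hM6 h2 h6 h8 h10 i₁ i₂ i₃ hE hT hB₄ hB₅ hτΨ h12 h13 h23 hTf hB₄f hB₅f 0
    (C := (⨁ Tf).prod ((⨁ B₄f).prod (⨁ B₅f))) ⟨AbelianVariety.prodLift 0 (𝟙 _), AbelianVariety.snd _ _, 1, one_ne_zero, by
      rw [AbelianVariety.prodLift_snd, one_smul]⟩

end Family

end Summit.HodgeConjecture.CorCM.SexticOcticDecicWeil

end
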